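import Mathlib.Analysis.FunctionalSpaces.SobolevInequality
import Mathlib.Analysis.InnerProductSpace.Calculus
import Mathlib.Analysis.SpecialFunctions.SmoothTransition
import Mathlib.MeasureTheory.Function.LpSpace.Complete
import Literature.Analysis.FluidPDE.SteadyDSolutionAsymptotics
import Literature.Analysis.FluidPDE.LeraySeparationOfEnergyTools
import HarnessLib

/-!
# The Gagliardo–Nirenberg–Sobolev inequality for `C¹` fields vanishing at infinity
# (Galdi 2011, Thm II.6.1 = Wang 2025, Thm 1.5, whole-space case with limit `u₀ = 0`)

Analysis/FluidPDE proofs file (theorems only: no definitions, no named facts). Mathlib proves the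
Gagliardo–Nirenberg–Sobolev inequality `‖u‖_{L^{p'}} ≤ C ‖Du‖_{L^p}` for `u ∈ C¹_c`
(`MeasureTheory.eLpNorm_le_eLpNorm_fderiv_of_eq`), and the tree removes the compact-support
hypothesis for `u ∈ L^q` (`SobolevWholeSpace`, truncation in SPACE). Here the decay hypothesis is
the one of Leray's problem — `u(x) → 0` as `|x| → ∞` — and the truncation is in the RANGE:
`w_ε = χ(|u|²/ε²) u` with `χ = 0` on `(-∞,0]`, `χ = 1` on `[1,∞)` applied to `|u|²/ε² − 1`
(`Real.smoothTransition`) is `C¹`, compactly supported (on the compact set `{|u| ≥ ε}`), with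
`‖Dw_ε‖ ≤ (1 + 4C_χ)‖Du‖` pointwise; Mathlib's inequality for `w_ε` and Fatou's lemma in `L^{p'}`
(`w_ε → u` pointwise) give

  `‖u‖_{L^{p'}} ≤ (1 + 4C_χ) C ‖Du‖_{L^p}`   for every `C¹` map `u : E → F` with `u → 0` at infinity,

`1 ≤ p < n = dim E`, `p'⁻¹ = p⁻¹ − n⁻¹` (`F` a finite-dimensional inner product space). This is the
whole-space case of Galdi 2011, Thm II.6.1 (= Wang 2025, Thm 1.5: for `u ∈ D^{1,q}(Ω)`, `Ω` an
exterior domain, there is a unique constant `u₀` with `u − u₀ ∈ L^{nq/(n−q)}`), in which the decay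
`u → 0` identifies `u₀ = 0`; the constant is not the sharp one.

Consequences typed for the steady Liouville lines (director-ns #208 (1)(b), items
stmt-NavierStokesRegularity-0895 and -0896, obligation O1b′): a `D`-solution of the steady
Navier–Stokes system on `ℝ³` with `u → 0` lies in `L⁶` (`memLp_six_of_isDSolution_of_tendsto_zero`),
so that Wang 2025 Thm 2.1 (= Galdi X.5.1, named fact `wang2025_thm21_DSolution_uniformDecay`, which
carries Wang's class hypothesis `u ∈ L⁶`) yields the pressure limit at infinity under exactly the
hypotheses of `GaldiLiouvilleGate.GaldiLiouville`
(`exists_tendsto_pressure_of_tendsto_zero`, conditional on that named fact; any viscosity `ν > 0`).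

## References

* G. P. Galdi, *An Introduction to the Mathematical Theory of the Navier–Stokes Equations.
  Steady-State Problems*, 2nd ed., Springer (2011), Thm II.6.1 and Thm X.5.1. [Galdi2011]
* W. Wang (王文栋), *稳态Navier–Stokes方程的Liouville定理*, Science Press (2025), Thm 1.5 (held
  `book:anonnd-navier-stokesliouville`, chunk p0013) and Thm 2.1. [Wang2025]
* L. C. Evans, *Partial Differential Equations*, 2nd ed. (2010), §5.6.1 (truncation proof of the
  `W^{1,p}` extension). [Evans2010]
-/

noncomputable section

namespace Literature.Analysis.FluidPDE

open _root_.MeasureTheory _root_.Filter _root_.Set _root_.Function _root_.Module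
open scoped ENNReal NNReal Topology RealInnerProductSpace

section General

variable {E : Type*} [NormedAddCommGroup E] [InnerProductSpace ℝ E] [FiniteDimensional ℝ E]
  [MeasurableSpace E] [BorelSpace E]
variable {F : Type*} [NormedAddCommGroup F] [InnerProductSpace ℝ F] [FiniteDimensional ℝ F]

omit [FiniteDimensional ℝ E] [MeasurableSpace E] [BorelSpace E] [FiniteDimensional ℝ F] in
/-- **Range truncation of a `C¹` field** (the step replacing Evans's space truncation when only
`u → 0` at infinity is known): for `ε > 0` and the profile `χ(t) = smoothTransition (t − 1)`
(`χ = 0` for `t ≤ 1`, `χ = 1` for `t ≥ 2`, `|χ'| ≤ C`), the field `w = χ(‖u‖²/ε²) u` is `C¹` with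
`‖Dw‖ ≤ (1 + 4C) ‖Du‖` pointwise, vanishes where `‖u‖ ≤ ε` and equals `u` where `‖u‖² ≥ 2ε²`.
[cite: Evans2010, §5.6.1 proof of Thm. 2 (truncation)] -/
theorem rangeCutoff_facts {u : E → F} (hu : ContDiff ℝ 1 u) {C : ℝ}
    (hC : ∀ t, |deriv Real.smoothTransition t| ≤ C) {ε : ℝ} (hε : 0 < ε) :
    ContDiff ℝ 1 (fun x => Real.smoothTransition (ε⁻¹ ^ 2 * ‖u x‖ ^ 2 - 1) • u x) ∧
    (∀ x, ‖fderiv ℝ (fun x => Real.smoothTransition (ε⁻¹ ^ 2 * ‖u x‖ ^ 2 - 1) • u x) x‖ ≤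
      (1 + 4 * C) * ‖fderiv ℝ u x‖) ∧
    (∀ x, ‖u x‖ ≤ ε → Real.smoothTransition (ε⁻¹ ^ 2 * ‖u x‖ ^ 2 - 1) • u x = 0) ∧
    (∀ x, 2 * ε ^ 2 ≤ ‖u x‖ ^ 2 → Real.smoothTransition (ε⁻¹ ^ 2 * ‖u x‖ ^ 2 - 1) • u x = u x) := by
  have hC0 : 0 ≤ C := (abs_nonneg _).trans (hC 0)
  set g : E → ℝ := fun x => ε⁻¹ ^ 2 * ‖u x‖ ^ 2 - 1 with hg
  have hud : Differentiable ℝ u := hu.differentiable one_ne_zero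
  have hnsq : ContDiff ℝ 1 fun x => ‖u x‖ ^ 2 := (contDiff_norm_sq ℝ).comp hu
  have hgC1 : ContDiff ℝ 1 g := (contDiff_const.mul hnsq).sub contDiff_const
  have hχC1 : ContDiff ℝ 1 (fun x => Real.smoothTransition (g x)) :=
    Real.smoothTransition.contDiff.comp hgC1
  refine ⟨hχC1.smul hu, fun x => ?_, fun x hx => ?_, fun x hx => ?_⟩
  · -- the derivative
    have hgx : HasFDerivAt g (ε⁻¹ ^ 2 • ((2 : ℝ) • (innerSL ℝ (u x)).comp (fderiv ℝ u x))) x := by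
      have h1 : HasFDerivAt (fun y => ‖u y‖ ^ 2) ((2 : ℝ) • (innerSL ℝ (u x)).comp (fderiv ℝ u x)) x := by
        have h := (hud x).hasFDerivAt.norm_sq
        rwa [two_smul, ← two_smul ℝ] at h
      have h2 := (h1.const_mul (ε⁻¹ ^ 2)).sub_const (1 : ℝ)
      simpa [hg, smul_eq_mul] using h2
    have hχd : HasDerivAt Real.smoothTransition (deriv Real.smoothTransition (g x)) (g x) :=
      ((Real.smoothTransition.contDiff (n := 1)).differentiable one_ne_zero _).hasDerivAt
    have hχg : HasFDerivAt (fun y => Real.smoothTransition (g y))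
        (deriv Real.smoothTransition (g x) • (ε⁻¹ ^ 2 • ((2 : ℝ) • (innerSL ℝ (u x)).comp
          (fderiv ℝ u x)))) x := hχd.comp_hasFDerivAt x hgx
    have hw : HasFDerivAt (fun y => Real.smoothTransition (ε⁻¹ ^ 2 * ‖u y‖ ^ 2 - 1) • u y)
        (Real.smoothTransition (g x) • fderiv ℝ u x + (deriv Real.smoothTransition (g x) •
          (ε⁻¹ ^ 2 • ((2 : ℝ) • (innerSL ℝ (u x)).comp (fderiv ℝ u x)))).smulRight (u x)) x :=
      hχg.smul (hud x).hasFDerivAt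
    rw [hw.fderiv]
    -- bounds
    have hS01 : 0 ≤ Real.smoothTransition (g x) ∧ Real.smoothTransition (g x) ≤ 1 :=
      ⟨Real.smoothTransition.nonneg _, Real.smoothTransition.le_one _⟩
    have hA : ‖Real.smoothTransition (g x) • fderiv ℝ u x‖ ≤ ‖fderiv ℝ u x‖ := by
      rw [norm_smul, Real.norm_of_nonneg hS01.1]
      calc Real.smoothTransition (g x) * ‖fderiv ℝ u x‖ ≤ 1 * ‖fderiv ℝ u x‖ :=
            mul_le_mul_of_nonneg_right hS01.2 (norm_nonneg _)
        _ = ‖fderiv ℝ u x‖ := one_mul _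
    -- `|χ'(g)| · (‖u‖²/ε²) ≤ 2C`: `χ' = 0` where `g > 1`, and `‖u‖²/ε² = g + 1 ≤ 2` where `g ≤ 1`
    have hχ'g : |deriv Real.smoothTransition (g x)| * (ε⁻¹ ^ 2 * ‖u x‖ ^ 2) ≤ 2 * C := by
      by_cases hgx1 : g x ≤ 1
      · have hle : ε⁻¹ ^ 2 * ‖u x‖ ^ 2 ≤ 2 := by
          have : g x = ε⁻¹ ^ 2 * ‖u x‖ ^ 2 - 1 := rfl
          linarith
        calc |deriv Real.smoothTransition (g x)| * (ε⁻¹ ^ 2 * ‖u x‖ ^ 2) ≤ C * 2 :=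
              mul_le_mul (hC _) hle (by positivity) hC0
          _ = 2 * C := by ring
      · push Not at hgx1
        have hev : Real.smoothTransition =ᶠ[𝓝 (g x)] fun _ => (1 : ℝ) := by
          filter_upwards [Ioi_mem_nhds hgx1] with t ht
          exact Real.smoothTransition.one_of_one_le (le_of_lt ht)
        rw [hev.deriv_eq, deriv_const, abs_zero, zero_mul]
        positivity
    have hB : ‖(deriv Real.smoothTransition (g x) • (ε⁻¹ ^ 2 • ((2 : ℝ) •
        (innerSL ℝ (u x)).comp (fderiv ℝ u x)))).smulRight (u x)‖ ≤ 4 * C * ‖fderiv ℝ u x‖ := by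
      rw [ContinuousLinearMap.norm_smulRight_apply, norm_smul, norm_smul, norm_smul,
        Real.norm_eq_abs, Real.norm_eq_abs, Real.norm_eq_abs,
        abs_of_nonneg (by positivity : (0 : ℝ) ≤ ε⁻¹ ^ 2), abs_of_nonneg (by norm_num : (0 : ℝ) ≤ 2)]
      have hcomp : ‖(innerSL ℝ (u x)).comp (fderiv ℝ u x)‖ ≤ ‖u x‖ * ‖fderiv ℝ u x‖ := by
        calc ‖(innerSL ℝ (u x)).comp (fderiv ℝ u x)‖ ≤ ‖innerSL ℝ (u x)‖ * ‖fderiv ℝ u x‖ :=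
              ContinuousLinearMap.opNorm_comp_le _ _
          _ = ‖u x‖ * ‖fderiv ℝ u x‖ := by rw [innerSL_apply_norm]
      calc |deriv Real.smoothTransition (g x)| * (ε⁻¹ ^ 2 * (2 * ‖(innerSL ℝ (u x)).comp
              (fderiv ℝ u x)‖)) * ‖u x‖
          ≤ |deriv Real.smoothTransition (g x)| * (ε⁻¹ ^ 2 * (2 * (‖u x‖ * ‖fderiv ℝ u x‖))) *
              ‖u x‖ := by gcongr
        _ = 2 * (|deriv Real.smoothTransition (g x)| * (ε⁻¹ ^ 2 * ‖u x‖ ^ 2)) * ‖fderiv ℝ u x‖ := by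
            ring
        _ ≤ 2 * (2 * C) * ‖fderiv ℝ u x‖ := by gcongr
        _ = 4 * C * ‖fderiv ℝ u x‖ := by ring
    calc ‖Real.smoothTransition (g x) • fderiv ℝ u x + (deriv Real.smoothTransition (g x) •
            (ε⁻¹ ^ 2 • ((2 : ℝ) • (innerSL ℝ (u x)).comp (fderiv ℝ u x)))).smulRight (u x)‖
        ≤ ‖fderiv ℝ u x‖ + 4 * C * ‖fderiv ℝ u x‖ := (norm_add_le _ _).trans (add_le_add hA hB)
      _ = (1 + 4 * C) * ‖fderiv ℝ u x‖ := by ring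
  · -- `‖u x‖ ≤ ε`: the profile vanishes
    have hle : ε⁻¹ ^ 2 * ‖u x‖ ^ 2 - 1 ≤ 0 := by
      have h1 : ‖u x‖ ^ 2 ≤ ε ^ 2 := pow_le_pow_left₀ (norm_nonneg _) hx 2
      have h2 : ε⁻¹ ^ 2 * ‖u x‖ ^ 2 ≤ ε⁻¹ ^ 2 * ε ^ 2 :=
        mul_le_mul_of_nonneg_left h1 (by positivity)
      have h3 : ε⁻¹ ^ 2 * ε ^ 2 = 1 := by field_simp
      linarith
    rw [Real.smoothTransition.zero_of_nonpos hle, zero_smul]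
  · -- `‖u x‖² ≥ 2ε²`: the profile is `1`
    have hge : 1 ≤ ε⁻¹ ^ 2 * ‖u x‖ ^ 2 - 1 := by
      have h2 : ε⁻¹ ^ 2 * (2 * ε ^ 2) ≤ ε⁻¹ ^ 2 * ‖u x‖ ^ 2 :=
        mul_le_mul_of_nonneg_left hx (by positivity)
      have h3 : ε⁻¹ ^ 2 * (2 * ε ^ 2) = 2 := by field_simp
      linarith
    rw [Real.smoothTransition.one_of_one_le hge, one_smul]

/-- **GNS for `C¹` fields vanishing at infinity** (Galdi 2011 Thm II.6.1 / Wang 2025 Thm 1.5,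
whole space, `u₀ = 0`): for `1 ≤ p`, `0 < n = dim E`, `p'⁻¹ = p⁻¹ − n⁻¹`, there is an absolute `K`
with `‖u‖_{L^{p'}(μ)} ≤ K ‖Du‖_{L^p(μ)}` for every `C¹` map `u : E → F` with `u(x) → 0` as
`|x| → ∞` (range truncation `χ(|u|²/ε²)u ∈ C¹_c`, Mathlib's compactly supported inequality, Fatou).
[cite: Wang2025, Thm 1.5] -/
theorem exists_eLpNorm_le_of_tendsto_cocompact (μ : Measure E) [μ.IsAddHaarMeasure]
    {p p' : ℝ≥0} (hp : 1 ≤ p) (hn : 0 < finrank ℝ E)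
    (hp' : (p' : ℝ)⁻¹ = p⁻¹ - (finrank ℝ E : ℝ)⁻¹) :
    ∃ K : ℝ≥0, ∀ u : E → F, ContDiff ℝ 1 u → Tendsto u (cocompact E) (𝓝 0) →
      eLpNorm u p' μ ≤ K * eLpNorm (fderiv ℝ u) p μ := by
  -- the absolute bound of `smoothTransition'`
  obtain ⟨C, hC0, hC⟩ : ∃ C : ℝ, 0 ≤ C ∧ ∀ t, |deriv Real.smoothTransition t| ≤ C := by
    have hcont : Continuous (deriv Real.smoothTransition) :=
      (Real.smoothTransition.contDiff (n := 1)).continuous_deriv le_rfl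
    obtain ⟨C, hC⟩ := isCompact_Icc.exists_bound_of_continuousOn (s := Icc (0 : ℝ) 1)
      hcont.continuousOn
    refine ⟨max C 0, le_max_right _ _, fun t => ?_⟩
    by_cases ht : t ∈ Icc (0 : ℝ) 1
    · exact (hC t ht).trans (le_max_left _ _)
    · have hd : deriv Real.smoothTransition t = 0 := by
        rcases lt_or_gt_of_ne (fun h : t = 0 => ht ⟨h.ge, by rw [h]; exact zero_le_one⟩) with h0 | h0
        · have hev : Real.smoothTransition =ᶠ[𝓝 t] fun _ => (0 : ℝ) := by
            filter_upwards [Iio_mem_nhds h0] with s hs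
            exact Real.smoothTransition.zero_of_nonpos (le_of_lt hs)
          rw [hev.deriv_eq, deriv_const]
        · have h1 : 1 < t := by
            by_contra hle
            exact ht ⟨h0.le, not_lt.1 hle⟩
          have hev : Real.smoothTransition =ᶠ[𝓝 t] fun _ => (1 : ℝ) := by
            filter_upwards [Ioi_mem_nhds h1] with s hs
            exact Real.smoothTransition.one_of_one_le (le_of_lt hs)
          rw [hev.deriv_eq, deriv_const]
      rw [hd, abs_zero]; exact le_max_right _ _
  set A : ℝ≥0 := ⟨1 + 4 * C, by positivity⟩ with hA
  refine ⟨A * SNormLESNormFDerivOfEqConst F μ p, fun u hu hdec => ?_⟩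
  -- the truncations `w_n`, `ε_n = 1/(n+1)`
  set ε : ℕ → ℝ := fun n => 1 / ((n : ℝ) + 1) with hεdef
  have hε : ∀ n, 0 < ε n := fun n => by positivity
  set w : ℕ → E → F := fun n x => Real.smoothTransition ((ε n)⁻¹ ^ 2 * ‖u x‖ ^ 2 - 1) • u x with hw
  have hfacts := fun n => rangeCutoff_facts hu hC (hε n)
  have hwC1 : ∀ n, ContDiff ℝ 1 (w n) := fun n => (hfacts n).1
  have hwD : ∀ n x, ‖fderiv ℝ (w n) x‖ ≤ (1 + 4 * C) * ‖fderiv ℝ u x‖ := fun n => (hfacts n).2.1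
  -- compact support from the decay
  have hwc : ∀ n, HasCompactSupport (w n) := by
    intro n
    have hev : ∀ᶠ x in cocompact E, dist (u x) 0 < ε n := Metric.tendsto_nhds.1 hdec _ (hε n)
    obtain ⟨K, hK, hKsub⟩ := mem_cocompact.1 hev
    refine HasCompactSupport.of_support_subset_isCompact hK fun x hx => ?_
    by_contra hxK
    have h1 : dist (u x) 0 < ε n := hKsub hxK
    rw [dist_zero_right] at h1
    exact hx ((hfacts n).2.2.1 x h1.le)
  -- GNS for each truncation
  have hGNS : ∀ n, eLpNorm (w n) p' μ ≤
      (A * SNormLESNormFDerivOfEqConst F μ p : ℝ≥0) * eLpNorm (fderiv ℝ u) p μ := by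
    intro n
    have h1 := eLpNorm_le_eLpNorm_fderiv_of_eq μ (hwC1 n) (hwc n) hp hn hp'
    have h2 : eLpNorm (fderiv ℝ (w n)) p μ ≤ A • eLpNorm (fderiv ℝ u) p μ := by
      refine eLpNorm_le_nnreal_smul_eLpNorm_of_ae_le_mul (Eventually.of_forall fun x => ?_) p
      rw [← NNReal.coe_le_coe]; push_cast
      exact hwD n x
    rw [ENNReal.smul_def, smul_eq_mul] at h2
    calc eLpNorm (w n) p' μ ≤ SNormLESNormFDerivOfEqConst F μ p * eLpNorm (fderiv ℝ (w n)) p μ := h1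
      _ ≤ SNormLESNormFDerivOfEqConst F μ p * ((A : ℝ≥0∞) * eLpNorm (fderiv ℝ u) p μ) := by gcongr
      _ = (A * SNormLESNormFDerivOfEqConst F μ p : ℝ≥0) * eLpNorm (fderiv ℝ u) p μ := by
          push_cast; ring
  -- pointwise convergence `w_n → u`
  have hεt : Tendsto ε atTop (𝓝 0) := tendsto_one_div_add_atTop_nhds_zero_nat
  have hpt : ∀ x, Tendsto (fun n => w n x) atTop (𝓝 (u x)) := by
    intro x
    by_cases hx : u x = 0
    · have : ∀ n, w n x = 0 := fun n => by simp [hw, hx]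
      simp only [this, hx]; exact tendsto_const_nhds
    · have hpos : 0 < ‖u x‖ ^ 2 := by positivity
      have h2ε : Tendsto (fun n => 2 * ε n ^ 2) atTop (𝓝 0) := by
        simpa using (hεt.pow 2).const_mul 2
      have hev : ∀ᶠ n in atTop, w n x = u x := by
        filter_upwards [h2ε.eventually (Iio_mem_nhds hpos)] with n hn
        exact (hfacts n).2.2.2 x (le_of_lt hn)
      exact tendsto_const_nhds.congr' (hev.mono fun n hn => hn.symm)
  -- Fatou in `L^{p'}`
  have hF := MeasureTheory.Lp.eLpNorm_lim_le_liminf_eLpNorm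
    (fun n => (hwC1 n).continuous.aestronglyMeasurable) u (Eventually.of_forall hpt)
    (p := (p' : ℝ≥0∞)) (μ := μ)
  refine hF.trans ?_
  calc liminf (fun n => eLpNorm (w n) p' μ) atTop
      ≤ liminf (fun _ : ℕ => ((A * SNormLESNormFDerivOfEqConst F μ p : ℝ≥0) : ℝ≥0∞) *
          eLpNorm (fderiv ℝ u) p μ) atTop := liminf_le_liminf (Eventually.of_forall hGNS)
    _ = _ := liminf_const _

/-- **`u ∈ L^{p'}` for `C¹` fields vanishing at infinity with `Du ∈ L^p`** (membership form of
`exists_eLpNorm_le_of_tendsto_cocompact`). [cite: Wang2025, Thm 1.5] -/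
theorem memLp_of_tendsto_cocompact (μ : Measure E) [μ.IsAddHaarMeasure]
    {p p' : ℝ≥0} (hp : 1 ≤ p) (hn : 0 < finrank ℝ E)
    (hp' : (p' : ℝ)⁻¹ = p⁻¹ - (finrank ℝ E : ℝ)⁻¹) {u : E → F} (hu : ContDiff ℝ 1 u)
    (hdec : Tendsto u (cocompact E) (𝓝 0)) (hDu : eLpNorm (fderiv ℝ u) p μ < ∞) :
    MemLp u p' μ := by
  obtain ⟨K, hK⟩ := exists_eLpNorm_le_of_tendsto_cocompact (F := F) μ hp hn hp'
  exact ⟨hu.continuous.aestronglyMeasurable,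
    lt_of_le_of_lt (hK u hu hdec) (ENNReal.mul_lt_top ENNReal.coe_lt_top hDu)⟩

end General

/-! ### `D`-solutions on `ℝ³` -/

/-- **A steady `D`-solution on `ℝ³` tending to `0` at infinity lies in `L⁶(ℝ³)`** (Galdi 2011,
Thm II.6.1 with `u₀ = 0` / Wang 2025, Thm 1.5; `‖Du‖² ≤ |∇u|²_{Frobenius}` gives `Du ∈ L²` from the
Dirichlet integral). This is Wang's standing class `u ∈ Ḣ¹(ℝ³) ⊂ L⁶(ℝ³)` (p. 2) derived from the
hypotheses of Leray's problem (0.2)–(0.3). [cite: Wang2025, Thm 1.5] -/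
theorem memLp_six_of_isDSolution_of_tendsto_zero {ν : ℝ}
    {u : EuclideanSpace ℝ (Fin 3) → EuclideanSpace ℝ (Fin 3)} {p : EuclideanSpace ℝ (Fin 3) → ℝ}
    (hu : IsDSolution ν 0 u p) (hdec : Tendsto u (cocompact (EuclideanSpace ℝ (Fin 3))) (𝓝 0)) :
    MemLp u 6 (volume : Measure (EuclideanSpace ℝ (Fin 3))) := by
  have hC1 : ContDiff ℝ 1 u := hu.isSteadyNSSolution.contDiff_velocity.of_le (by norm_num)
  have hDu2 : eLpNorm (fderiv ℝ u) 2 (volume : Measure (EuclideanSpace ℝ (Fin 3))) < ⊤ := by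
    have hpt : ∀ x, ‖fderiv ℝ u x‖ₑ ^ (2 : ℝ) ≤ ENNReal.ofReal (frobeniusNormSq (fderiv ℝ u x)) :=
      fun x => by
        rw [show (2 : ℝ) = ((2 : ℕ) : ℝ) by norm_num, ENNReal.rpow_natCast,
          ← ofReal_norm, ← ENNReal.ofReal_pow (norm_nonneg _)]
        exact ENNReal.ofReal_le_ofReal (norm_sq_le_frobeniusNormSq (fderiv ℝ u x))
    rw [eLpNorm_eq_lintegral_rpow_enorm_toReal two_ne_zero ENNReal.ofNat_ne_top,
      ENNReal.toReal_ofNat]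
    exact ENNReal.rpow_lt_top_of_nonneg (by norm_num)
      (lt_top_iff_ne_top.1 (lt_of_le_of_lt (lintegral_mono hpt) hu.dirichlet_lt_top))
  have h := memLp_of_tendsto_cocompact (F := EuclideanSpace ℝ (Fin 3))
    (volume : Measure (EuclideanSpace ℝ (Fin 3))) (p := 2) (p' := 6) one_le_two
    (by rw [finrank_euclideanSpace_fin]; norm_num)
    (by rw [finrank_euclideanSpace_fin]; norm_num) hC1 hdec (by exact_mod_cast hDu2)
  exact_mod_cast h

/-- **The pressure of a steady `D`-solution tending to `0` at infinity has a limit at infinity**,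
for every viscosity `ν > 0` — Galdi 2011 Thm X.5.1 / Wang 2025 Thm 2.1 (the tree's named fact
`wang2025_thm21_DSolution_uniformDecay`, taken as a hypothesis) under exactly the hypotheses of
Leray's Liouville problem (`GaldiLiouvilleGate.GaldiLiouville`, stmt-NavierStokesRegularity-0895):
the class hypothesis `u ∈ L⁶` of the fact is supplied by `memLp_six_of_isDSolution_of_tendsto_zero`,
and the viscosity is normalised by `(u, p) ↦ (ν⁻¹u, ν⁻²p)`. Obligation O1b′ of the «cylinder
budget» lines. [cite: Wang2025, Thm 2.1] -/
theorem exists_tendsto_pressure_of_tendsto_zero (h : wang2025_thm21_DSolution_uniformDecay)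
    {ν : ℝ} (hν : 0 < ν)
    {u : EuclideanSpace ℝ (Fin 3) → EuclideanSpace ℝ (Fin 3)} {p : EuclideanSpace ℝ (Fin 3) → ℝ}
    (hu : IsDSolution ν 0 u p) (hdec : Tendsto u (cocompact (EuclideanSpace ℝ (Fin 3))) (𝓝 0)) :
    ∃ c : ℝ, Tendsto p (cocompact (EuclideanSpace ℝ (Fin 3))) (𝓝 c) := by
  have hν0 : ν ≠ 0 := hν.ne'
  -- normalise the viscosity
  have h1 : IsSteadyNSSolution 1 0 (ν⁻¹ • u) (ν⁻¹ ^ 2 • p) := by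
    simpa using hu.isSteadyNSSolution.viscosity_one hν0
  have hud : Differentiable ℝ u :=
    hu.isSteadyNSSolution.contDiff_velocity.differentiable (by norm_num)
  have hfrob : ∀ y, frobeniusNormSq (fderiv ℝ (ν⁻¹ • u) y) =
      (ν⁻¹) ^ 2 * frobeniusNormSq (fderiv ℝ u y) := by
    intro y
    rw [fderiv_const_smul (hud y) ν⁻¹]
    unfold frobeniusNormSq
    rw [Finset.mul_sum]
    refine Finset.sum_congr rfl fun i _ => ?_
    rw [_root_.smul_apply, norm_smul, mul_pow, Real.norm_eq_abs, sq_abs]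
  have hD : (∫⁻ y, ENNReal.ofReal (frobeniusNormSq (fderiv ℝ (ν⁻¹ • u) y))) < ⊤ := by
    have e : (fun y => ENNReal.ofReal (frobeniusNormSq (fderiv ℝ (ν⁻¹ • u) y))) =
        fun y => ENNReal.ofReal ((ν⁻¹) ^ 2) * ENNReal.ofReal (frobeniusNormSq (fderiv ℝ u y)) := by
      funext y; rw [hfrob y, ENNReal.ofReal_mul (sq_nonneg _)]
    rw [e, lintegral_const_mul' _ _ ENNReal.ofReal_ne_top]
    exact ENNReal.mul_lt_top ENNReal.ofReal_lt_top hu.dirichlet_lt_top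
  have hD1 : IsDSolution 1 0 (ν⁻¹ • u) (ν⁻¹ ^ 2 • p) := ⟨h1, hD⟩
  have hdec1 : Tendsto (ν⁻¹ • u) (cocompact (EuclideanSpace ℝ (Fin 3))) (𝓝 0) := by
    have h := hdec.const_smul ν⁻¹
    rw [smul_zero] at h
    exact h
  have h6 := memLp_six_of_isDSolution_of_tendsto_zero hD1 hdec1
  obtain ⟨c, hc⟩ := wang2025_thm21_DSolution_uniformDecay.tendsto_pressure h hD1 h6
  refine ⟨ν ^ 2 * c, ?_⟩
  have h2 := hc.const_mul (ν ^ 2)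
  refine h2.congr fun x => ?_
  simp only [Pi.smul_apply, smul_eq_mul]
  field_simp

end Literature.Analysis.FluidPDE

end
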